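import Summits.ResolutionOfSingularities.ResolutionOfSingularities.Theorems.WildPurityWildSymbolRegularPoint
import Literature.AlgebraicGeometry.Resolution.RankOneReduction
import HarnessLib

/-!
# `WildSymbol` (stmt-ResolutionOfSingularities-17133), line `birth` — a witness forces FAILURE OF RELATIVE
# LOCAL UNIFORMIZATION (modulo Gros–Suwa 1988), at a rank-one place (modulo Novacoski–Spivakovsky 2014)

Support file for crux #2 of route `ResolutionOfSingularities/WildPurity`
(`Summit.ResolutionOfSingularities.ResolutionOfSingularities.Theses.WildPurity.WildSymbol`), line `birth`
(lead c3, crux cycle 4). It ties the crux BY NAME to the standard open problem of the area, in the form the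
tree already has: `Literature.AlgebraicGeometry.Resolution.RelLocalUniformization k K O` (Novacoski–Spivakovsky
2014, Def. 2.20: every affine model `R ⊆ O` of `K` is refined inside `O` by a finitely generated `A ⊇ R` that is
regular at the centre of `O`).

## What is proved

* `divIntegral_antitone` — condition (D) only WEAKENS when the model grows inside `O` (`R ≤ A`): fewer
  divisorial places are tested.
* `isRegularLocalRing_locAt_of_atPrime` — regularity of `Localization.AtPrime (centreIdeal A O h)` (the form
  used by `RelLocalUniformization`) is regularity of the subring `locAt A O ⊆ K` (the form used by the line).
* `mem_Unr_of_divIntegral_of_relLU` — **modulo `GrosSuwa1988_purity`, relative local uniformization of `O`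
  kills every candidate class above every model**: if `RelLocalUniformization k K O` then for every finitely
  generated `R ⊆ O` with `Frac R = K` and every `α` with (D) for `R`, `α ∈ Unr(O)`. Proof: refine `R` to a
  regular-at-the-centre `A ⊆ O` (the hypothesis), weaken (D) to `A` (`divIntegral_antitone`), and apply the
  landed regular-point theorem `mem_Unr_of_divIntegral_of_isRegularLocalRing` (Gersten purity at the centre +
  local domination).
* `not_relLU_of_witness`, `exists_not_relLU_of_wildSymbol` — hence **a witness of the crux is a valuation ring
  of a finitely generated extension of a perfect field WITHOUT relative local uniformization** (modulo
  Gros–Suwa): constructing a `WildSymbol` is at least as hard as refuting local uniformization in positive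
  characteristic (necessarily in transcendence degree `≥ 4`, by Cossart–Piltant 2019 — not used here).
* `exists_rankOne_not_relLU_of_wildSymbol` — with the named fact `NovacoskiSpivakovsky2014` (reduction of local
  uniformization to rank one) the failure can be taken at a RANK-ONE valuation ring (of some extension of the
  same perfect ground field).
* `not_wildSymbol_of_relLU`, `not_wildSymbol_of_rankOne_relLU` — the contrapositives: relative local
  uniformization for all valuation rings (resp. all rank-one valuation rings) of function fields over perfect
  fields of characteristic `p`, for all `p`, REFUTES the crux (modulo Gros–Suwa, resp. + Novacoski–Spivakovsky).

All statements are conditional on the tree's named fact `GrosSuwa1988_purity` (Gros–Suwa 1988, Thm. 1.4) exactly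
as `PurityTransfer_of_grosSuwa1988` and `mem_Unr_of_divIntegral_of_isRegularLocalRing` are; nothing here
concludes the crux positively, and no definition is declared.
-/

noncomputable section

-- single-problem summit: the doubled namespace component `ResolutionOfSingularities` is forced
set_option linter.dupNamespace false

namespace Summit.ResolutionOfSingularities.ResolutionOfSingularities.Theorems.WildSymbol.Birth

open Summit.ResolutionOfSingularities.ResolutionOfSingularities.Theses.WildPurity (WildSymbol)
open Literature.AlgebraicGeometry.Resolution
open Literature.NumberTheory.GaloisCohomology
open Literature.NumberTheory.GaloisCohomology.KatoCohomologySymbolic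

variable {k K : Type} [Field k] [Field K] [Algebra k K]

/-- **(D) is antitone in the model**: if `R ≤ A` then (D) for `R` implies (D) for `A` (every divisorial
place tested for `A` — containing `A`, centre on `A` inside the centre of `O` — is tested for `R`). [folklore] -/
theorem divIntegral_antitone (p : ℕ) {R A : Subalgebra k K} (hRA : R ≤ A) (O : ValuationSubring K)
    {α : G K ⧸ N p K} (h : DivIntegral p k K R O α) : DivIntegral p k K A O α :=
  fun W hkW hdvr hess hAW hcen =>
    h W hkW hdvr hess (fun _ hx => hAW (hRA hx)) (fun x hxR hxW => hcen x (hRA hxR) hxW)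

/-- **Regularity at the centre, two forms.** For a model `A ⊆ O` with `Frac A = K`: if the abstract
localisation `Localization.AtPrime (centreIdeal A O h)` of `A` at the centre `𝔪_O ∩ A` is a regular local
ring, then so is the subring `locAt A O ⊆ K` of fractions `a/s`, `s ∈ A ∖ 𝔪_O` (transport along
`Localization.algEquiv` to `localizationIn K _`, then along `locAt_eq_localizationIn`). [folklore] -/
theorem isRegularLocalRing_locAt_of_atPrime (A : Subalgebra k K) [IsFractionRing A K]
    (O : ValuationSubring K) (h : A.toSubring ≤ O.toSubring)
    (hreg : IsRegularLocalRing (Localization.AtPrime (centreIdeal A O h))) :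
    IsRegularLocalRing (locAt (A : Set K) O) := by
  let 𝔮 : Ideal A := centreIdeal A O h
  haveI : IsLocalization.AtPrime (localizationIn K 𝔮) 𝔮 :=
    Localization.subalgebra.isLocalization_ofField K 𝔮.primeCompl 𝔮.primeCompl_le_nonZeroDivisors
  haveI := hreg
  haveI h1 : IsRegularLocalRing (localizationIn K 𝔮) :=
    IsRegularLocalRing.of_ringEquiv
      (IsLocalization.algEquiv 𝔮.primeCompl (Localization.AtPrime 𝔮) (localizationIn K 𝔮)).toRingEquiv
  have e : (localizationIn K 𝔮).toSubring ≃+* locAt (A : Set K) O :=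
    RingEquiv.subringCongr (locAt_eq_localizationIn A O h).symm
  exact IsRegularLocalRing.of_ringEquiv e

/-- **Relative local uniformization kills every candidate class (modulo Gros–Suwa 1988).** For `p` prime,
`k` perfect of characteristic `p`, `O ⊇ k` a valuation ring of `K` admitting RELATIVE local uniformization
(`RelLocalUniformization k K O`), every finitely generated `R ⊆ O` with `Frac R = K` and every `α ∈ G ⧸ N`
with (D) for `R`: `α ∈ Unr(O)`. Proof: the hypothesis refines `R` to a finitely generated `R ≤ A ⊆ O` regular
at the centre of `O`; (D) passes to `A` (`divIntegral_antitone`); the regular-point theorem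
`mem_Unr_of_divIntegral_of_isRegularLocalRing` (Gersten purity at the centre, local domination) concludes.
[cite: GrosSuwa1988, Thm. 1.4] -/
theorem mem_Unr_of_divIntegral_of_relLU (hGS : GrosSuwa1988_purity.{0}) {p : ℕ} (hp : p.Prime)
    [CharP k p] [PerfectField k] (O : ValuationSubring K) (hLU : RelLocalUniformization k K O)
    (R : Subalgebra k K) (hRfg : R.FG) (hRO : R.toSubring ≤ O.toSubring) (hRfr : IsFractionRing R K)
    (α : G K ⧸ N p K) (hdiv : DivIntegral p k K R O α) : α ∈ Unr p K O.toSubring := by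
  obtain ⟨A, hAO, hRA, hAfg, hreg⟩ := hLU R hRfg hRfr hRO
  haveI hAfr : IsFractionRing A K := isFractionRing_of_le hRA hRfr
  exact mem_Unr_of_divIntegral_of_isRegularLocalRing hGS hp O A hAfg hAO hAfr
    (isRegularLocalRing_locAt_of_atPrime A O hAO hreg) α (divIntegral_antitone p hRA O hdiv)

/-- **A witness of the crux sits at a valuation ring WITHOUT relative local uniformization** (modulo
Gros–Suwa 1988): the data `(R, α)` of a witness at `O` — `R ⊆ O` finitely generated with `Frac R = K`,
(D) for `R`, `α ∉ Unr(O)` — refute `RelLocalUniformization k K O`. [cite: GrosSuwa1988, Thm. 1.4] -/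
theorem not_relLU_of_witness (hGS : GrosSuwa1988_purity.{0}) {p : ℕ} (hp : p.Prime)
    [CharP k p] [PerfectField k] (O : ValuationSubring K)
    (R : Subalgebra k K) (hRfg : R.FG) (hRO : R.toSubring ≤ O.toSubring) (hRfr : IsFractionRing R K)
    (α : G K ⧸ N p K) (hdiv : DivIntegral p k K R O α) (hα : α ∉ Unr p K O.toSubring) :
    ¬ RelLocalUniformization k K O :=
  fun hLU => hα (mem_Unr_of_divIntegral_of_relLU hGS hp O hLU R hRfg hRO hRfr α hdiv)

/-- **`WildSymbol` ⇒ failure of relative local uniformization somewhere** (modulo Gros–Suwa 1988): a witness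
yields a prime `p`, a perfect field `k` of characteristic `p`, a finitely generated `K/k` and a valuation ring
`O ⊇ k` of `K` with `¬ RelLocalUniformization k K O`. So exhibiting a witness is at least as hard as refuting
local uniformization in positive characteristic. [cite: GrosSuwa1988, Thm. 1.4] -/
theorem exists_not_relLU_of_wildSymbol (hGS : GrosSuwa1988_purity.{0}) (hW : WildSymbol) :
    ∃ p : ℕ, p.Prime ∧ ∃ (k K : Type) (_ : Field k) (_ : CharP k p) (_ : PerfectField k) (_ : Field K)
      (_ : Algebra k K), (⊤ : IntermediateField k K).FG ∧ ∃ O : ValuationSubring K,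
      (∀ c : k, algebraMap k K c ∈ O) ∧ ¬ RelLocalUniformization k K O := by
  obtain ⟨p, hp, k, K, ik, icp, ipf, iK, ialg, hfg, O, hO, R, hR, hRO, hfr, α, hdiv, hα⟩ :=
    wildSymbol_iff.mp hW
  exact ⟨p, hp, k, K, ik, icp, ipf, iK, ialg, hfg, O, hO,
    not_relLU_of_witness hGS hp O R hR hRO hfr α hdiv hα⟩

/-- **… and at a RANK-ONE place** (modulo Gros–Suwa 1988 and Novacoski–Spivakovsky 2014, Thm. 1.1 — the
reduction of local uniformization to rank one, tree fact `NovacoskiSpivakovsky2014`): a witness yields a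
perfect field `k` of characteristic `p` and a rank-one valuation ring `O'` of some field `K' ⊇ k` with
`¬ RelLocalUniformization k K' O'` (for `K'` not finitely generated over `k` the predicate holds vacuously, so
`K'/k` is automatically a function field). [cite: NovacoskiSpivakovsky2014, Thm. 1.1] -/
theorem exists_rankOne_not_relLU_of_wildSymbol (hGS : GrosSuwa1988_purity.{0})
    (hNS : NovacoskiSpivakovsky2014) (hW : WildSymbol) :
    ∃ p : ℕ, p.Prime ∧ ∃ (k : Type) (_ : Field k) (_ : CharP k p) (_ : PerfectField k)
      (K' : Type) (_ : Field K') (_ : Algebra k K') (O' : ValuationSubring K'),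
      Nonempty O'.valuation.RankOne ∧ ¬ RelLocalUniformization k K' O' := by
  obtain ⟨p, hp, k, K, ik, icp, ipf, iK, ialg, -, O, -, hO⟩ := exists_not_relLU_of_wildSymbol hGS hW
  by_contra hcon
  refine hO (hNS k ?_ K O)
  intro K' _ _ O' hr
  by_contra hLU
  exact hcon ⟨p, hp, k, ik, icp, ipf, K', inferInstance, inferInstance, O', hr, hLU⟩

/-- **Relative local uniformization refutes the crux** (modulo Gros–Suwa 1988): if every valuation ring
containing the (perfect, characteristic-`p`) ground field of every finitely generated extension admits relative
local uniformization, for every prime `p`, then `¬ WildSymbol`. (Known for transcendence degree `≤ 3`,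
Cossart–Piltant 2019; open beyond — which is where any witness must live.) [cite: GrosSuwa1988, Thm. 1.4] -/
theorem not_wildSymbol_of_relLU (hGS : GrosSuwa1988_purity.{0})
    (hLU : ∀ (p : ℕ), p.Prime → ∀ (k K : Type) [Field k] [CharP k p] [PerfectField k] [Field K]
      [Algebra k K], (⊤ : IntermediateField k K).FG → ∀ O : ValuationSubring K,
      (∀ c : k, algebraMap k K c ∈ O) → RelLocalUniformization k K O) :
    ¬ WildSymbol := by
  intro hW
  obtain ⟨p, hp, k, K, ik, icp, ipf, iK, ialg, hfg, O, hO, hnot⟩ := exists_not_relLU_of_wildSymbol hGS hW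
  exact hnot (hLU p hp k K hfg O hO)

/-- **Rank-one relative local uniformization refutes the crux** (modulo Gros–Suwa 1988 and
Novacoski–Spivakovsky 2014): if for every perfect field `k` of prime characteristic every RANK-ONE valuation ring
of every field `K ⊇ k` admits relative local uniformization over `k`, then `¬ WildSymbol`.
[cite: NovacoskiSpivakovsky2014, Thm. 1.1] -/
theorem not_wildSymbol_of_rankOne_relLU (hGS : GrosSuwa1988_purity.{0}) (hNS : NovacoskiSpivakovsky2014)
    (hLU1 : ∀ (p : ℕ), p.Prime → ∀ (k : Type) [Field k] [CharP k p] [PerfectField k]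
      (K : Type) [Field K] [Algebra k K] (O : ValuationSubring K),
      Nonempty O.valuation.RankOne → RelLocalUniformization k K O) :
    ¬ WildSymbol := by
  intro hW
  obtain ⟨p, hp, k, ik, icp, ipf, K', iK', ialg', O', hr, hnot⟩ :=
    exists_rankOne_not_relLU_of_wildSymbol hGS hNS hW
  exact hnot (hLU1 p hp k K' O' hr)

end Summit.ResolutionOfSingularities.ResolutionOfSingularities.Theorems.WildSymbol.Birth

end
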